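import Literature.AlgebraicGeometry.HodgeTheory.SemiregularVariationalHodgeTwistedPerfect
import Literature.AlgebraicGeometry.HodgeTheory.HomComplexSigmaSingle
import Literature.AlgebraicGeometry.HodgeTheory.HomComplexSigmaConj
import Literature.AlgebraicGeometry.HodgeTheory.HomComplexSigmaWindow
import Literature.AlgebraicGeometry.HodgeTheory.HigherSigmaOfIso
import HarnessLib

/-!
# The INTENDED admissibility notion of the twisted-perfect door: Buchweitz–Flenner's `I`-semiregularity of a
# strictly perfect complex (`HomComplex.IsISemiregularC`), as a `PerfectAdmissibility` — and its single-sheaf slice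

Family `hodge`, layer `Literature/AlgebraicGeometry/HodgeTheory`. VOCABULARY ONLY: one definition with body and PROVED
lemmas; NO named fact, nothing asserted about any conjecture. Typed by the LT-H1 literature seat `hodge-lit-semireg-typer`
(cell `pub-hsemireg`, tranche «SEMIREGULARITY CONSUMERS», consumer №4 `TwistedPerfectDoor`).

`SemiregularVariationalHodgeTwistedPerfect.lean` (Design 3) made the semiregularity hypothesis of the door
`TwistedPerfectDoorVHC C Adm` / of the object class `twistedReflexiveClass C Adm` a SCHEMA PARAMETER
`Adm : PerfectAdmissibility`, because the INTENDED notion — «`(σ_q(E))_{q+1 ∈ I}` jointly injective on `Ext²_{D(X₀)}(E, E)`»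
([BuchweitzFlenner2003] Def. 4.1 for a perfect complex and §5 «`I`-semiregular»; [Perry2026Semiregularity] Def. 2.4) — had a
carrier only on the venture side of the tree, and recorded: «TODO(general form): a Literature-level `σ` for strictly perfect
complexes (re-home the venture's `HomComplexSigma` stack), after which `Adm` is fixed to `IsISemiregularC … {q | q+1 ∈ I}` […]
and the schema disappears». The re-homing has happened (`HomComplexSigma*.lean` in this layer: `HomComplex.sigmaC`,
`HomComplex.IsISemiregularC X₀ E a b hE I`, with the agreement `HomComplex.isISemiregularC_single₀_iff` for a vector bundle in
degree `0`, invariance under isomorphisms of complexes `HomComplex.IsISemiregularC.of_iso` and window independence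
`HomComplex.isISemiregularC_iff_of_window`). This file types the intended notion in this layer and proves that it CONTAINS the
door file's typed slice `bfSingleAdmissible`:

* §1 `sigmaPerfectAdmissible : PerfectAdmissibility` — «`E` is a strictly perfect complex (concentrated in some window `[a, b]`,
  every term finite locally free) and `(σ_q(E))_{q+1 ∈ I}` is jointly injective on `Hom_{D(X₀)}(Q E, (Q E)⟦2⟧)`» in Mathlib's
  derived category of all `𝒪_{X₀}`-modules (constructed instance `HasDerivedCategory.standard`); the window is immaterial
  (`sigmaPerfectAdmissible_iff`, by `isISemiregularC_iff_of_window`).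
* §2 `sigmaPerfectAdmissible_of_bfSingleAdmissible` — a complex with zero terms off degree `0` whose degree-`0` term is
  isomorphic to an `I`-semiregular vector bundle `F` (the door file's `bfSingleAdmissible`) is `sigmaPerfectAdmissible`: it is
  isomorphic as a complex to `F[0]` (Mathlib `CochainComplex.exists_iso_single`), `I`-semiregularity of modules is invariant
  under `F ≅ F'` (`isISemiregular_of_iso`), agrees with the complex-level notion on `F[0]` (`isISemiregularC_single₀_iff`) and
  the latter is invariant under isomorphisms of complexes (`IsISemiregularC.of_iso`); and the converse direction on single
  complexes `sigmaPerfectAdmissible_single₀_iff` («`E₀[0]` is σ-admissible iff `E₀` is `I`-semiregular»).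
* §3 the door bookkeeping, by the door file's own monotonicity lemmas: `twistedReflexiveClass C bfSingleAdmissible ⟹
  twistedReflexiveClass C sigmaPerfectAdmissible` and `TwistedPerfectDoorVHC C sigmaPerfectAdmissible ⟹
  TwistedPerfectDoorVHC C bfSingleAdmissible` — a door stated for `I`-semiregular PERFECT complexes serves the refereed
  Buchweitz–Flenner slice (`TwistedPerfectDoorVHC.bf_slice`).

NOT here: Perry's second hypothesis «`Ext^{<0}(E₀, E₀) = 0`» (Lieblich's universally gluable complexes — it belongs to the
algebraisation step, not to [BuchweitzFlenner2003]'s notion; the venture's `gluableSigmaAdmissible` adds it together with the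
cell clause `{1..n} ⊆ I`); any claim that `TwistedPerfectDoorVHC C sigmaPerfectAdmissible` holds (in print: Perry 2026 Thm. 1.1,
PREPRINT; Markman 2025 Conj. 7.3.9; refereed infinitesimal form: Pridham 2024 Cor. 2.25 / Rem. 2.26–2.27 — see
`SemiregularReducedObstructions*.lean`); any explicit variety. Nothing here asserts HC / HC_AV / W₆ / HC_Kum4Type.

References: [BuchweitzFlenner2003] Compositio Math. 137 (2003), Def. 4.1 (`σ` of a perfect complex, arXiv p. 20 L47–57) and §5
(«`ℰ_0` is called `I`-semiregular if the part `σ_I` of the semiregularity map is injective», arXiv p. 25 L52–62) ·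
[Perry2026Semiregularity] arXiv:2604.00511, Def. 2.4 / Rem. 2.5 (semiregular perfect complex = `σ` injective; PREPRINT, used only
for the WORDING of a definition).
-/

noncomputable section

open CategoryTheory CategoryTheory.Limits AlgebraicGeometry
open Literature.AlgebraicTopology.SingularHomology
open Literature.AlgebraicGeometry.KTheory

namespace Literature.AlgebraicGeometry.HodgeTheory

open Literature.AlgebraicGeometry.Motives Literature.AlgebraicGeometry.Modules

/-! ### §1 The notion -/

/-- **Buchweitz–Flenner `I`-semiregularity of a strictly perfect complex, as an admissibility notion for the twisted-perfect
door**: `sigmaPerfectAdmissible n X₀ I E` iff `E` is concentrated in some window `[a, b]` with every term finite locally free and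
the part `(σ_q(E))_{q+1 ∈ I}` of its semiregularity map is JOINTLY INJECTIVE on `Ext²(E, E) = Hom_{D(X₀)}(Q E, (Q E)⟦2⟧)`
(`HomComplex.IsISemiregularC`, [BF03] Def. 4.1 without the units `(-1)^q/q!`, in Mathlib's derived category of all
`𝒪_{X₀}`-modules for `HasDerivedCategory.standard`). The relative dimension `n` is not used (the type is the door's schema
type). «`ℰ_0` is called `I`-semiregular if the part `σ_I : Ext²_{X_0}(ℰ_0, ℰ_0) → ∏_{p ∈ I} H^{p+1}(X_0, Ω^{p−1}_{X_0})` of the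
semiregularity map is injective» — index `p` = Chern degree, i.e. form degree `q = p − 1`.
[cite: BuchweitzFlenner2003, Def. 4.1 and §5 (I-semiregular)] [cite: Perry2026Semiregularity, Def. 2.4 and Rem. 2.5 (wording only)] -/
def sigmaPerfectAdmissible : PerfectAdmissibility := fun _ X₀ I E =>
  ∃ (a b : ℤ) (_ : E.IsStrictlyGE a) (_ : E.IsStrictlyLE b) (hE : ∀ i, IsFiniteLocallyFree (E.X i)),
    letI := HasDerivedCategory.standard X₀.left.Modules
    HomComplex.IsISemiregularC X₀ E a b hE {q | q + 1 ∈ I}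

variable {n : ℕ} {X₀ : SchemeOver ℂ} {I : Finset ℕ} {E : CochainComplex X₀.left.Modules ℤ}

/-- **The window is immaterial**: for any window `[a, b]` containing `E` and any proof `hE` that the terms are finite locally
free, `sigmaPerfectAdmissible n X₀ I E` is `I`-semiregularity in THAT window (`HomComplex.isISemiregularC_iff_of_window`).
[cite: BuchweitzFlenner2003, Def. 4.1 and §5 (I-semiregular)] -/
theorem sigmaPerfectAdmissible_iff (a b : ℤ) [E.IsStrictlyGE a] [E.IsStrictlyLE b]
    (hE : ∀ i, IsFiniteLocallyFree (E.X i)) :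
    sigmaPerfectAdmissible n X₀ I E ↔
      letI := HasDerivedCategory.standard X₀.left.Modules
      HomComplex.IsISemiregularC X₀ E a b hE {q | q + 1 ∈ I} := by
  letI := HasDerivedCategory.standard X₀.left.Modules
  constructor
  · rintro ⟨a', b', hGE, hLE, hE', h⟩
    exact (HomComplex.isISemiregularC_iff_of_window X₀ E a b a' b' hE _).1 h
  · intro h
    exact ⟨a, b, inferInstance, inferInstance, hE, h⟩

/-! ### §2 The single-sheaf slice -/

/-- **A vector bundle `E₀` placed in degree `0` is σ-admissible iff `E₀` is `I`-semiregular as a module** (the tree's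
`IsISemiregular hE₀`, real Atiyah class and trace of `SemiregularityHigherSigma.lean`): the PROVED agreement
`HomComplex.isISemiregularC_single₀_iff` in the window `[0, 0]`, made window-free by §1.
[cite: BuchweitzFlenner2003, §5 (I-semiregular) and §4 (arXiv p. 20 L5–8: a module in degree 0 is a perfect complex)] -/
theorem sigmaPerfectAdmissible_single₀_iff (E₀ : X₀.left.Modules) (hE₀ : IsFiniteLocallyFree E₀) :
    sigmaPerfectAdmissible n X₀ I (HomComplex.single₀ X₀.left E₀) ↔ IsISemiregular hE₀ {q | q + 1 ∈ I} := by
  letI := HasDerivedCategory.standard X₀.left.Modules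
  have hK : ∀ i, IsFiniteLocallyFree ((HomComplex.single₀ X₀.left E₀).X i) :=
    (IsBoundedVBComplex.single E₀ hE₀ 0).isFiniteLocallyFree
  haveI : (HomComplex.single₀ X₀.left E₀).IsStrictlyGE 0 :=
    inferInstanceAs (((CochainComplex.singleFunctor X₀.left.Modules 0).obj E₀).IsStrictlyGE 0)
  haveI : (HomComplex.single₀ X₀.left E₀).IsStrictlyLE 0 :=
    inferInstanceAs (((CochainComplex.singleFunctor X₀.left.Modules 0).obj E₀).IsStrictlyLE 0)
  rw [sigmaPerfectAdmissible_iff 0 0 hK]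
  exact HomComplex.isISemiregularC_single₀_iff X₀ E₀ hE₀ hK {q | q + 1 ∈ I}

/-- **The door file's typed slice is contained in the intended notion**: if `E` has zero terms off degree `0` and `E⁰ ≅ F`
with `F` an `I`-semiregular vector bundle (`bfSingleAdmissible`), then `E` is σ-admissible. Proof: `E ≅ M[0]` as a complex
for `M = E⁰` (Mathlib `CochainComplex.exists_iso_single`), `M ≅ F` so `M` is `I`-semiregular (`isISemiregular_of_iso`),
hence `M[0]` is (`isISemiregularC_single₀_iff`), hence `E` is (`IsISemiregularC.of_iso`).
[cite: BuchweitzFlenner2003, §5 (I-semiregular) and Def. 4.1] -/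
theorem sigmaPerfectAdmissible_of_bfSingleAdmissible (h : bfSingleAdmissible n X₀ I E) :
    sigmaPerfectAdmissible n X₀ I E := by
  letI := HasDerivedCategory.standard X₀.left.Modules
  obtain ⟨h0, F, hF, ⟨eF⟩, hsr⟩ := h
  -- `E` is concentrated in degree `0` with finite locally free terms
  haveI hGE : E.IsStrictlyGE 0 := (CochainComplex.isStrictlyGE_iff E 0).2 fun i hi => h0 i (by omega)
  haveI hLE : E.IsStrictlyLE 0 := (CochainComplex.isStrictlyLE_iff E 0).2 fun i hi => h0 i (by omega)
  have hE : ∀ i, IsFiniteLocallyFree (E.X i) := fun i => by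
    by_cases hi : i = 0
    · subst hi
      exact isFiniteLocallyFree_of_iso eF.symm hF
    · exact KZero.isFiniteLocallyFree_of_isZero (h0 i hi)
  -- `E ≅ M[0]` as a complex
  obtain ⟨M, ⟨ψ⟩⟩ := CochainComplex.exists_iso_single E 0
  -- `M ≅ E⁰ ≅ F`, so `M` is an `I`-semiregular vector bundle
  have eM : F ≅ M :=
    eF.symm ≪≫ (HomologicalComplex.eval _ _ 0).mapIso ψ ≪≫ HomologicalComplex.singleObjXSelf (ComplexShape.up ℤ) 0 M
  have hM : IsFiniteLocallyFree M := isFiniteLocallyFree_of_iso eM hF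
  have hsrM : IsISemiregular hM {q | q + 1 ∈ I} := isISemiregular_of_iso eM hF hM hsr
  -- the single complex `M[0]` is `I`-semiregular at the complex level
  have hKM : ∀ i, IsFiniteLocallyFree ((HomComplex.single₀ X₀.left M).X i) :=
    (IsBoundedVBComplex.single M hM 0).isFiniteLocallyFree
  haveI : (HomComplex.single₀ X₀.left M).IsStrictlyGE 0 :=
    inferInstanceAs (((CochainComplex.singleFunctor X₀.left.Modules 0).obj M).IsStrictlyGE 0)
  haveI : (HomComplex.single₀ X₀.left M).IsStrictlyLE 0 :=
    inferInstanceAs (((CochainComplex.singleFunctor X₀.left.Modules 0).obj M).IsStrictlyLE 0)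
  have hsrC : HomComplex.IsISemiregularC X₀ (HomComplex.single₀ X₀.left M) 0 0 hKM {q | q + 1 ∈ I} :=
    (HomComplex.isISemiregularC_single₀_iff X₀ M hM hKM {q | q + 1 ∈ I}).2 hsrM
  -- transport along `ψ : E ≅ M[0]`
  exact ⟨0, 0, hGE, hLE, hE, HomComplex.IsISemiregularC.of_iso X₀ 0 0 hE hKM ψ hsrC⟩

/-! ### §3 Door bookkeeping -/

/-- **Object classes**: the `B`-twisted class over the Buchweitz–Flenner single-sheaf slice is contained in the class over
the intended notion (`twistedReflexiveClass.mono`). [cite: BuchweitzFlenner2003, §5 (I-semiregular)]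
[cite: Perry2026Semiregularity, Thm. 1.1 (hypotheses) and Def. 2.4 (wording only)] -/
theorem twistedReflexiveClass_sigmaPerfect_of_bfSingle {C : ChernCharacterBetti} {κ : (p : ℕ) → complexBetti X₀ (2 * p)}
    (h : twistedReflexiveClass C bfSingleAdmissible n X₀ I κ) :
    twistedReflexiveClass C sigmaPerfectAdmissible n X₀ I κ :=
  h.mono fun _ _ _ _ hA => sigmaPerfectAdmissible_of_bfSingleAdmissible hA

/-- **An `I`-semiregular vector bundle `E₀` with `κ_p = ch_p(E₀)` (`p ∈ I`) is a member of the class over the intended notion**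
(witness `E₀[0]`, `B₀ = 0`). [cite: BuchweitzFlenner2003, §5 (I-semiregular) and Thm. 5.1 (hypotheses)] -/
theorem twistedReflexiveClass_sigmaPerfect_of_isISemiregular {C : ChernCharacterBetti}
    {κ : (p : ℕ) → complexBetti X₀ (2 * p)} (E₀ : X₀.left.Modules) (hE₀ : IsFiniteLocallyFree E₀)
    (hsr : IsISemiregular hE₀ {q | q + 1 ∈ I}) (hκ : ∀ p ∈ I, κ p = C.ch X₀ E₀ p) :
    twistedReflexiveClass C sigmaPerfectAdmissible n X₀ I κ :=
  twistedReflexiveClass_of_isISemiregular (fun _ _ _ _ hA => sigmaPerfectAdmissible_of_bfSingleAdmissible hA) E₀ hE₀ hsr hκ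

/-- **Doors**: the twisted-perfect door stated for `I`-semiregular PERFECT complexes (the intended notion) implies the door for
the Buchweitz–Flenner single-sheaf slice (`TwistedPerfectDoorVHC.anti`), hence feeds `TwistedPerfectDoorVHC.bf_slice`.
Nothing is asserted about either door. [cite: BuchweitzFlenner2003, §5 Thm. 5.1 (binder shape)] -/
theorem TwistedPerfectDoorVHC.bfSingle_of_sigmaPerfect {C : ChernCharacterBetti}
    (h : TwistedPerfectDoorVHC C sigmaPerfectAdmissible) : TwistedPerfectDoorVHC C bfSingleAdmissible :=
  h.anti fun _ _ _ _ hA => sigmaPerfectAdmissible_of_bfSingleAdmissible hA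

/-- **The refereed Buchweitz–Flenner conclusion through the σ-door**: under `TwistedPerfectDoorVHC C sigmaPerfectAdmissible`,
the Chern classes `ch_p(E₀)` (`p ∈ I`) of an `I`-semiregular vector bundle whose transports stay of type `(p, p)` on `U` are
algebraic on the fibres near `s₀` — `TwistedPerfectDoorVHC.bf_slice` at the intended notion. [cite: BuchweitzFlenner2003, §5 Thm. 5.1] -/
theorem TwistedPerfectDoorVHC.bf_slice_sigmaPerfect {C : ChernCharacterBetti}
    (h : TwistedPerfectDoorVHC C sigmaPerfectAdmissible)
    ⦃𝒳 S : SchemeOver ℂ⦄ (π : 𝒳 ⟶ S) (n : ℕ) (hπ : IsSmoothProjectiveFamily π n)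
    (hS : _root_.AlgebraicGeometry.Smooth S.hom) ⦃U : Set (ComplexPoints S)⦄ (hU : IsCohomologicallyLocallyTrivialOn π U)
    (s₀ : U) (X₀ : SchemeOver ℂ) (e : X₀ ≅ fiberOver π s₀.1) (E₀ : X₀.left.Modules) (hE₀ : IsFiniteLocallyFree E₀)
    (I : Finset ℕ) (hsr : IsISemiregular hE₀ {q | q + 1 ∈ I})
    (hHodge : ∀ p ∈ I, ∀ (t : U) (γ : Path.Homotopic.Quotient s₀ t),
      IsOfHodgeType n (fiberOver π t.1) (2 * p) p p
        (transportFun π (2 * p) hU γ (complexBetti.map e.inv (2 * p) (C.ch X₀ E₀ p)))) :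
    ∃ (W : Set (ComplexPoints S)) (hWo : IsOpen W) (hW₀ : s₀.1 ∈ W) (hWU : W ⊆ U),
      ∀ p ∈ I, ∀ (t : W) (γ : Path.Homotopic.Quotient (⟨s₀.1, hW₀⟩ : W) t),
        transportFun π (2 * p) (hU.mono hWU hWo) γ (complexBetti.map e.inv (2 * p) (C.ch X₀ E₀ p)) ∈
          algebraicClasses (fiberOver π t.1) p :=
  h.bf_slice (fun _ _ _ _ hA => sigmaPerfectAdmissible_of_bfSingleAdmissible hA) π n hπ hS hU s₀ X₀ e E₀ hE₀ I hsr hHodge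

end Literature.AlgebraicGeometry.HodgeTheory

end
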